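import Mathlib
import Summits.Ventures.HodgeRepro2.T5QuadraticTrace

/-!
# T5CMSymplectic — the symplectic space `Res_{K/K⁺}(V ⊗_K W, tr(h ⊗ s))` on a CM field, every
hypothesis discharged (Tier-5 §N2.9.2 support)

`T5DeltaTwistBilinForm` (p399055) built the `F`-bilinear form `tr_{E/F}(h ⊗ s)` on `Res_{E/F}(V ⊗_E W)`
in the coordinate (Kronecker) model under three hypotheses on the pair `(E, F, star)` — `hF` (star
fixes `F`), `htr` (`tr z = z + star z`) and `2 ≠ 0`; `T5QuadraticTrace` (p399848) reduced `htr` to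
«`E/F` Galois of degree `2` and `star ≠ id`».  On Mathlib's CM field `K` with its maximal real
subfield `K⁺ = maximalRealSubfield K` and its `StarRing` instance (`star = complexConj K`,
`NumberField.IsCMField.starRing`) ALL of them hold:

* `star_algebraMap` (`star` fixes `K⁺` pointwise — `complexConj_apply_eq_self`),
  `exists_star_ne` (`star ≠ id` — `complexConj_ne_one`);
* `algebraMap_trace_eq_add_star` / `algebraMap_norm_eq_mul_star` (`tr z = z + z̄`, `N z = z z̄`);
* **`isAlt_and_nondegenerate_traceBilin`**: for `M` hermitian, `N` skew-hermitian with unit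
  determinants, the `K⁺`-bilinear form `tr_{K/K⁺}(h_M ⊗ s_N)` on `ι × κ → K` is alternating and
  non-degenerate — a symplectic `K⁺`-space of dimension `|ι|·|κ|·2` (`finrank_tensorSpace`),
  `3·2·2 = 12` for the datum (`finrank_tensorSpace_three_two`).

Prose (unchanged): that the datum's local spaces are these Gram matrices over the completions, and
Kudla's splitting.
-/

namespace Summit.Ventures.HodgeRepro2.T5CMSymplectic

open Summit.Ventures.HodgeRepro2 NumberField NumberField.IsCMField Matrix
open scoped Kronecker

variable (K : Type*) [Field K] [NumberField K] [IsCMField K]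

/-- `star` (= the complex conjugation) fixes the maximal real subfield pointwise. -/
theorem star_algebraMap (c : maximalRealSubfield K) :
    star (algebraMap (maximalRealSubfield K) K c) = algebraMap (maximalRealSubfield K) K c :=
  complexConj_apply_eq_self K c

/-- `star` is not the identity on a CM field. -/
theorem exists_star_ne : ∃ z : K, star z ≠ z := by
  by_contra h
  apply complexConj_ne_one K
  ext z
  exact not_not.mp fun hz => h ⟨z, hz⟩

/-- `tr_{K/K⁺} z = z + z̄`. -/
theorem algebraMap_trace_eq_add_star (z : K) :
    algebraMap (maximalRealSubfield K) K (Algebra.trace (maximalRealSubfield K) K z) = z + star z :=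
  T5QuadraticTrace.algebraMap_trace_eq_add_star
    (Algebra.IsQuadraticExtension.finrank_eq_two (maximalRealSubfield K) K) (star_algebraMap K)
    (exists_star_ne K) z

/-- `N_{K/K⁺} z = z · z̄`. -/
theorem algebraMap_norm_eq_mul_star (z : K) :
    algebraMap (maximalRealSubfield K) K (Algebra.norm (maximalRealSubfield K) z) = z * star z :=
  T5QuadraticTrace.algebraMap_norm_eq_mul_star
    (Algebra.IsQuadraticExtension.finrank_eq_two (maximalRealSubfield K) K) (star_algebraMap K)
    (exists_star_ne K) z

/-- **The symplectic space of §N2.9.2 on a CM field, every hypothesis discharged**: for `M` hermitian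
and `N` skew-hermitian with unit determinants, the `K⁺`-bilinear form `tr_{K/K⁺}(h_M ⊗ s_N)` on
`Res_{K/K⁺}(K^ι ⊗_K K^κ)` is alternating and non-degenerate. -/
theorem isAlt_and_nondegenerate_traceBilin {ι κ : Type*} [Fintype ι] [Fintype κ] [DecidableEq ι]
    [DecidableEq κ] {M : Matrix ι ι K} {N : Matrix κ κ K} (hM : Mᴴ = M) (hN : Nᴴ = -N)
    (hMd : IsUnit M.det) (hNd : IsUnit N.det) :
    (T5DeltaTwistBilinForm.traceBilin (star_algebraMap K) (M ⊗ₖ N)).IsAlt ∧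
      (T5DeltaTwistBilinForm.traceBilin (star_algebraMap K) (M ⊗ₖ N)).Nondegenerate :=
  T5QuadraticTrace.isAlt_and_nondegenerate_traceBilin_of_quadratic
    (Algebra.IsQuadraticExtension.finrank_eq_two (maximalRealSubfield K) K) (star_algebraMap K)
    (exists_star_ne K) hM hN hMd hNd two_ne_zero

/-- The `K⁺`-dimension of `Res_{K/K⁺}(K^ι ⊗_K K^κ)` is `|ι|·|κ|·2`. -/
theorem finrank_tensorSpace {ι κ : Type*} [Fintype ι] [Fintype κ] :
    Module.finrank (maximalRealSubfield K) (ι × κ → K) = Fintype.card ι * Fintype.card κ * 2 :=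
  T5QuadraticTrace.finrank_tensorSpace_of_quadratic
    (Algebra.IsQuadraticExtension.finrank_eq_two (maximalRealSubfield K) K)

/-- For the datum (`rank 3` and `rank 2`), the symplectic `K⁺`-space has dimension `12`. -/
theorem finrank_tensorSpace_three_two :
    Module.finrank (maximalRealSubfield K) (Fin 3 × Fin 2 → K) = 12 := by
  rw [finrank_tensorSpace]
  simp

end Summit.Ventures.HodgeRepro2.T5CMSymplectic
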